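import Summits.ResolutionOfSingularities.ResolutionOfSingularities.Theorems.PurelyInseparableDim4ResConeTwoSlotFlag
import Summits.ResolutionOfSingularities.ResolutionOfSingularities.Theorems.PurelyInseparableDim4ResConeShearTransport
import Summits.ResolutionOfSingularities.ResolutionOfSingularities.Theorems.PurelyInseparableDim4ResConeShadeTwoStep
import HarnessLib
import HarnessLib.Audit.Tags

/-!
# Purely inseparable four-folds — THE L-SECTOR OF THE TWO-SLOT TAIL DIES IN TWO STEPS
# (cell `res-dim4-pi`, K2(p) lane, slice B, brick K24a-R2)

[OURS · counted 0 · cell `res-dim4-pi` · K2(p) lane holder res-dim4-p-12 g3 (bus 2026-08-29 03:44Z).]  Nothing here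
proves K2(p)/K2(5), `NoIsolatedTrap p p` or resolution of singularities in dimension ≥ 4 / characteristic `p`.

The two-slot `A∞` tail of the light regime (`p = 5`, `d = 3`, boundary `x_A x_B x_ν` of weights `1`, `ν` idle, `f`
free) was closed in kernel form by res-dim4-p-1 g4 (`no_twoSlot_tail_five_of_slot`) modulo two named hypotheses:
`hslot` (no rotation) and `hT` (T-sector: the vertex form charges the free letter, `ℓ f ≠ 0`).  This file kills the
complementary **L-sector** `ℓ f = 0` at the level of TWO CONSECUTIVE SLOT STEPS with different charts, in fixed
coordinates and for arbitrary translations along the free letter: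

* the direction equation `ℓ κ + ℓ ⬝ (β e_f) = 0` of a slot step `κ` reads `ℓ κ = 0` in the L-sector
  (`apply_eq_zero_of_direction_of_apply_eq_zero`), and the L-sector persists under slot steps (`lSector_persists`);
* so at a letter change `A` then `B` the residual cone at the first state lies in `K[x_B, x_ν]` and at the second in
  `K[x_A, x_ν]` (`apply_eq_zero_of_mem_support_C_mul_linearForm_pow` turns the vanishing of `ℓ` into exponent
  facts, `cone_exponents_first` / `cone_exponents_second` dress them on `F`);
* **step A** (`exponents_after_slot_step_A`): every monomial `E` of the new `F` with `E_A = 1` has degree `6`;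
* **step B** (`five_le_degIn_after_slot_step_B`): then every monomial `T` of the next `F` has `T_A + T_B + T_ν ≥ 5`,
  i.e. `5 ≤ ord_{(x_A, x_B, x_ν)} F` — the `x_f`-axis is `5`-fold and the state is NOT isolated
  (`not_isIsolated_after_lSector_change`, via `IsolationCert.not_isIsolated_of_le_ordAlong_of_ne_univ`).

With res-dim4-p-9's `exists_letter_change_of_isolated_two_slot` (a late `A → B` change exists on every all-isolated
witnessed two-slot chain) the hypothesis `hT` of the two-slot tail theorem drops.

bears_on: LADDER-RESOLUTION:D157-DOOR2 (res-dim4-pi · K2(p) · slice B · K24a-R2 L-sector).  Supports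
stmt-ResolutionOfSingularities-16155 (helper).
-/

set_option linter.dupNamespace false -- mandated namespace of this single-conjunct summit

namespace Summit.ResolutionOfSingularities.ResolutionOfSingularities.Theorems.PIDim4

namespace ResCone

open MvPolynomial Finset
open Literature.AlgebraicGeometry.Resolution
open Literature.AlgebraicGeometry.Resolution.CentreBlowup
open Literature.AlgebraicGeometry.Resolution.Hauser2010
open Literature.AlgebraicGeometry.Resolution.HauserPerlega2019

variable {K : Type} [Field K]

/-! ## 1. The L-sector: direction equation and persistence -/

/-- **Direction equation in the L-sector**: `ℓ κ + ℓ ⬝ (β e_f) = 0` with `ℓ f = 0` reads `ℓ κ = 0`. [folklore] -/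
theorem apply_eq_zero_of_direction_of_apply_eq_zero {ℓ : Fin 4 → K} {κ f : Fin 4} {β : K} (hℓf : ℓ f = 0)
    (hdir : ℓ κ + dotProduct ℓ (Pi.single f β) = 0) : ℓ κ = 0 := by
  rw [dotProduct_single, hℓf, zero_mul, add_zero] at hdir
  exact hdir

/-- **THE L-SECTOR PERSISTS**: if the vertex form propagates off the chart letter (`ℓ_{k+1} i = λ_k ℓ_k i` for
`i ≠ j k`) and `f` is never the chart from `k₁` on, then `ℓ_{k₁} f = 0` gives `ℓ_k f = 0` for all `k ≥ k₁`
(the mirror of `tSector_persists`, no `λ_k ≠ 0` needed). [folklore] -/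
theorem lSector_persists {j : ℕ → Fin 4} {ℓ : ℕ → Fin 4 → K} {lam : ℕ → K} {k₀ k₁ : ℕ} (hk₁ : k₀ ≤ k₁)
    (hprop : ∀ k, k₀ ≤ k → ∀ i, i ≠ j k → ℓ (k + 1) i = lam k * ℓ k i)
    {f : Fin 4} (hjf : ∀ k, k₁ ≤ k → j k ≠ f) (hL : ℓ k₁ f = 0) : ∀ k, k₁ ≤ k → ℓ k f = 0 := by
  intro k hk
  induction k, hk using Nat.le_induction with
  | base => exact hL
  | succ k hk ih => rw [hprop k (by omega) f (hjf k hk).symm, ih, mul_zero]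

/-! ## 2. From the vanishing of `ℓ` to exponent facts -/

/-- On the support of the power cone `a · (Σ ℓ_k x_k)^d` a letter with `ℓ_i = 0` does not occur. [folklore] -/
theorem apply_eq_zero_of_mem_support_C_mul_linearForm_pow {a : K} {ℓ : Fin 4 → K} {d : ℕ} {i : Fin 4}
    (hℓ : ℓ i = 0) {μ : Fin 4 →₀ ℕ}
    (hμ : μ ∈ (C a * (∑ k, C (ℓ k) * (X k : MvPolynomial (Fin 4) K)) ^ d).support) : μ i = 0 := by
  classical
  have h1 : i ∉ (∑ k, C (ℓ k) * (X k : MvPolynomial (Fin 4) K)).vars := by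
    intro hi
    have h := vars_sum_subset Finset.univ (fun k => C (ℓ k) * (X k : MvPolynomial (Fin 4) K)) hi
    rw [Finset.mem_biUnion] at h
    obtain ⟨k, -, hk⟩ := h
    by_cases hki : k = i
    · subst hki
      rw [hℓ, C_0, zero_mul, vars_0] at hk
      exact Finset.notMem_empty _ hk
    · have h2 := vars_mul _ _ hk
      rw [vars_C, Finset.empty_union, vars_X, Finset.mem_singleton] at h2
      exact hki h2.symm
  have h2 : i ∉ (C a * (∑ k, C (ℓ k) * (X k : MvPolynomial (Fin 4) K)) ^ d).vars := fun hi => by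
    have h := vars_mul _ _ hi
    rw [vars_C, Finset.empty_union] at h
    exact h1 (vars_pow _ _ h)
  by_contra hne
  exact h2 ((mem_vars_iff_mem_support i).mpr ⟨μ, hμ, Finsupp.mem_support_iff.mpr hne⟩)

/-- Coordinates of the boundary `e_A + e_B + e_ν`. [folklore] -/
theorem triple_apply {A B ν f : Fin 4} (hAB : A ≠ B) (hAν : A ≠ ν) (hAf : A ≠ f) (hBν : B ≠ ν) (hBf : B ≠ f)
    (hνf : ν ≠ f) :
    (Finsupp.single A 1 + Finsupp.single B 1 + Finsupp.single ν 1 : Fin 4 →₀ ℕ) A = 1 ∧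
      (Finsupp.single A 1 + Finsupp.single B 1 + Finsupp.single ν 1 : Fin 4 →₀ ℕ) B = 1 ∧
      (Finsupp.single A 1 + Finsupp.single B 1 + Finsupp.single ν 1 : Fin 4 →₀ ℕ) ν = 1 ∧
      (Finsupp.single A 1 + Finsupp.single B 1 + Finsupp.single ν 1 : Fin 4 →₀ ℕ) f = 0 := by
  refine ⟨?_, ?_, ?_, ?_⟩
  · simp [hAB.symm, hAν.symm]
  · simp [hAB, hBν.symm]
  · simp [hAν, hBν]
  · simp [hAf, hBf, hνf]

/-- The degree of the boundary `e_A + e_B + e_ν` is `3`. [folklore] -/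
theorem degree_triple (A B ν : Fin 4) :
    (Finsupp.single A 1 + Finsupp.single B 1 + Finsupp.single ν 1 : Fin 4 →₀ ℕ).degree = 3 := by
  rw [map_add, map_add, Finsupp.degree_single, Finsupp.degree_single, Finsupp.degree_single]

variable [DecidableEq K]

omit [DecidableEq K] in
/-- **The honest layer reads the residual cone**: a monomial `x^D` of `F` of degree `ord₀ F` lies above `x^r` with
`D − r` in the support of the residual cone. [folklore] -/
theorem tsub_mem_support_resForm {s : State K} {o : ℕ} (ho : ordZero s.F = o)
    (hr : ∀ d ∈ s.F.support, s.r ≤ d) {D : Fin 4 →₀ ℕ} (hD : D ∈ s.F.support) (hdeg : D.degree = o) :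
    D - s.r ∈ (resForm s).support ∧ s.r + (D - s.r) = D := by
  have hle : s.r ≤ D := hr D hD
  have hsum : s.r + (D - s.r) = D := add_tsub_cancel_of_le hle
  have hdeg' : s.r.degree + (D - s.r).degree = o := by rw [← map_add, hsum, hdeg]
  refine ⟨?_, hsum⟩
  rw [MvPolynomial.mem_support_iff, coeff_resForm_eq_coeff_add ho (by omega) (by omega), hsum]
  exact MvPolynomial.mem_support_iff.mp hD

/-- Degree of an exponent on four named letters. [folklore] -/
theorem degree_eq_four_apply {A B ν f : Fin 4} (hAB : A ≠ B) (hAν : A ≠ ν) (hAf : A ≠ f) (hBν : B ≠ ν)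
    (hBf : B ≠ f) (hνf : ν ≠ f) (m : Fin 4 →₀ ℕ) : m.degree = m A + m B + m ν + m f := by
  conv_lhs => rw [eq_sum_single_four hAB hAν hAf hBν hBf hνf m]
  rw [degree_quad]

omit [DecidableEq K] in
/-- **Cone exponents at the first state** (chart `A` next; L-sector `ℓ f = 0` and direction `ℓ A = 0`): if the
residual cone avoids `x_A` and `x_f` and `r = e_A + e_B + e_ν`, every monomial of `F` of degree `ord₀ F` has
`A`-exponent `1` and `f`-exponent `0`. [OURS · bookkeeping] [folklore] -/
theorem cone_exponents_first {A B ν f : Fin 4} (hAB : A ≠ B) (hAν : A ≠ ν) (hAf : A ≠ f) (hBν : B ≠ ν)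
    (hBf : B ≠ f) (hνf : ν ≠ f) {s : State K} {o : ℕ} (ho : ordZero s.F = o)
    (hr : ∀ d ∈ s.F.support, s.r ≤ d)
    (hrABν : s.r = Finsupp.single A 1 + Finsupp.single B 1 + Finsupp.single ν 1)
    (hres : ∀ μ ∈ (resForm s).support, μ A = 0 ∧ μ f = 0) :
    ∀ D ∈ s.F.support, D.degree = o → D A = 1 ∧ D f = 0 := by
  intro D hD hdeg
  obtain ⟨hμ, hsum⟩ := tsub_mem_support_resForm ho hr hD hdeg
  obtain ⟨hA, hf⟩ := hres _ hμ
  have hq := triple_apply hAB hAν hAf hBν hBf hνf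
  refine ⟨?_, ?_⟩
  · have h := congrArg (fun m : Fin 4 →₀ ℕ => m A) hsum
    simp only [Finsupp.add_apply] at h
    rw [← h, hA, hrABν, hq.1]
  · have h := congrArg (fun m : Fin 4 →₀ ℕ => m f) hsum
    simp only [Finsupp.add_apply] at h
    rw [← h, hf, hrABν, hq.2.2.2]

omit [DecidableEq K] in
/-- **Cone exponents at the second state** (chart `B` next; L-sector `ℓ f = 0` and direction `ℓ B = 0`): if the
residual cone of degree `3` avoids `x_B` and `x_f` and `r = e_A + e_B + e_ν`, every monomial of `F` of degree
`ord₀ F = 6` has `A`-exponent plus `ν`-exponent `= 5`. [OURS · bookkeeping] [folklore] -/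
theorem cone_exponents_second {A B ν f : Fin 4} (hAB : A ≠ B) (hAν : A ≠ ν) (hAf : A ≠ f) (hBν : B ≠ ν)
    (hBf : B ≠ f) (hνf : ν ≠ f) {s : State K} (ho : ordZero s.F = 6)
    (hr : ∀ d ∈ s.F.support, s.r ≤ d)
    (hrABν : s.r = Finsupp.single A 1 + Finsupp.single B 1 + Finsupp.single ν 1)
    (hres : ∀ μ ∈ (resForm s).support, μ B = 0 ∧ μ f = 0) :
    ∀ D ∈ s.F.support, D.degree = 6 → D A + D ν = 5 := by
  intro D hD hdeg
  obtain ⟨hμ, hsum⟩ := tsub_mem_support_resForm ho hr hD hdeg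
  obtain ⟨hB, hf⟩ := hres _ hμ
  have hq := triple_apply hAB hAν hAf hBν hBf hνf
  have hrdeg : s.r.degree = 3 := by rw [hrABν, degree_triple]
  have hμdeg : (D - s.r).degree = 3 := by
    have h : s.r.degree + (D - s.r).degree = 6 := by rw [← map_add, hsum, hdeg]
    omega
  rw [degree_eq_four_apply hAB hAν hAf hBν hBf hνf, hB, hf] at hμdeg
  have hrA : s.r A = 1 := by rw [hrABν]; exact hq.1
  have hrν : s.r ν = 1 := by rw [hrABν]; exact hq.2.2.1
  have hA := congrArg (fun m : Fin 4 →₀ ℕ => m A) hsum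
  have hν := congrArg (fun m : Fin 4 →₀ ℕ => m ν) hsum
  simp only [Finsupp.add_apply] at hA hν
  omega

/-! ## 3. One slot step in fixed coordinates: the source of a monomial -/

/-- **Sources under a slot step with a translation along `f`** (`j ≠ f`, `b = β e_f`, `q ≤ ord F`): every monomial
`x^E` of the new `F` comes from a monomial `x^m` of `F` with `E_j = |m| − q`, `E_f ≤ m_f` and `E_i = m_i` for the
other letters (shear `x_f ↦ x_f + β x_j`, chart law, cleaning only deletes). [OURS · bookkeeping] [folklore] -/
theorem exists_source_of_mem_support_step_single (q : ℕ) {j f : Fin 4} (hjf : j ≠ f) (β : K) (s : State K)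
    (hq : (q : ℕ∞) ≤ ordAlong Finset.univ s.F) {E : Fin 4 →₀ ℕ}
    (hE : E ∈ (CentreBlowup.step q Finset.univ j (Pi.single f β) s).F.support) :
    ∃ m ∈ s.F.support, E j = m.degree - q ∧ E f ≤ m f ∧ ∀ i, i ≠ j → i ≠ f → E i = m i := by
  classical
  obtain ⟨e, he, heE, -⟩ := exists_of_mem_support_step q j (by rw [Pi.single_eq_of_ne hjf]) s hq hE
  obtain ⟨m, hm, l, hl, rfl⟩ := exists_of_mem_support_shear_single hjf β s.F he
  have hdeg : ((m.update f (m f - l)).update j (m j + l)).degree = m.degree := by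
    have h1 : (m.update f (m f - l)).degree + l = m.degree := by
      have h := congrArg Finsupp.degree (Finsupp.erase_add_single f m)
      rw [map_add, Finsupp.degree_single] at h
      rw [Finsupp.update_eq_erase_add_single, map_add, Finsupp.degree_single]
      omega
    have h2 : ((m.update f (m f - l)).update j (m j + l)).degree = (m.update f (m f - l)).degree + l := by
      have h := congrArg Finsupp.degree (Finsupp.erase_add_single j (m.update f (m f - l)))
      rw [map_add, Finsupp.degree_single, Finsupp.coe_update, Function.update_of_ne hjf] at h
      rw [Finsupp.update_eq_erase_add_single, map_add, Finsupp.degree_single]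
      omega
    omega
  refine ⟨m, hm, ?_, ?_, ?_⟩
  · rw [← heE, chartExponent_univ_apply_self, hdeg]
  · rw [← heE, chartExponent_apply_of_ne q _ hjf.symm, Finsupp.coe_update, Function.update_of_ne hjf.symm,
      Finsupp.coe_update, Function.update_self]
    omega
  · intro i hij hif
    rw [← heE, chartExponent_apply_of_ne q _ hij, Finsupp.coe_update, Function.update_of_ne hij,
      Finsupp.coe_update, Function.update_of_ne hif]

/-! ## 4. The two steps -/

/-- **STEP A.** From a state whose monomials lie above `x_B x_ν`, have degree `≥ 6`, and whose degree-`6` monomials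
have `A`-exponent `1` and `f`-exponent `0` (the cone lies in `K[x_B, x_ν]`), the `x_A`-chart with any translation
`β e_f` (`p = q = 5`) gives a state whose monomials lie above `x_A x_B x_ν` and whose monomials with `A`-exponent
`1` have degree exactly `6`. [OURS] [folklore] -/
theorem exponents_after_slot_step_A {A B ν f : Fin 4} (hAB : A ≠ B) (hAν : A ≠ ν) (hAf : A ≠ f) (hBν : B ≠ ν)
    (hBf : B ≠ f) (hνf : ν ≠ f) (s : State K) (β : K) (hq : ((5 : ℕ) : ℕ∞) ≤ ordAlong Finset.univ s.F)
    (h6 : ∀ D ∈ s.F.support, 6 ≤ D.degree) (hbd : ∀ D ∈ s.F.support, 1 ≤ D B ∧ 1 ≤ D ν)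
    (hcone : ∀ D ∈ s.F.support, D.degree = 6 → D A = 1 ∧ D f = 0) {s₁ : State K}
    (hs₁ : s₁ = CentreBlowup.step 5 Finset.univ A (Pi.single f β) s) :
    (∀ E ∈ s₁.F.support, 1 ≤ E A ∧ 1 ≤ E B ∧ 1 ≤ E ν) ∧ (∀ E ∈ s₁.F.support, E A = 1 → E.degree = 6) := by
  subst hs₁
  refine ⟨fun E hE => ?_, fun E hE hEA => ?_⟩
  · obtain ⟨m, hm, hj, -, hi⟩ := exists_source_of_mem_support_step_single 5 hAf β s hq hE
    have h6m := h6 m hm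
    obtain ⟨hB, hν⟩ := hbd m hm
    rw [hj, hi B hAB.symm hBf, hi ν hAν.symm hνf]
    exact ⟨by omega, hB, hν⟩
  · obtain ⟨m, hm, hj, hf, hi⟩ := exists_source_of_mem_support_step_single 5 hAf β s hq hE
    have h6m := h6 m hm
    have hmdeg : m.degree = 6 := by omega
    obtain ⟨hmA, hmf⟩ := hcone m hm hmdeg
    rw [degree_eq_four_apply hAB hAν hAf hBν hBf hνf] at hmdeg ⊢
    rw [hi B hAB.symm hBf, hi ν hAν.symm hνf]
    omega

/-- **STEP B.** From a state whose monomials have degree `≥ 6` and lie above `x_A x_ν`, whose monomials with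
`A`-exponent `1` have degree `6`, and whose degree-`6` monomials have `A`-exponent plus `ν`-exponent `≥ 4` (the cone
lies in `K[x_A, x_ν]`), the `x_B`-chart with any translation `β′ e_f` (`p = q = 5`) gives a polynomial all of whose
monomials have `(A, B, ν)`-degree `≥ 5`. [OURS] [folklore] -/
theorem five_le_after_slot_step_B {A B ν f : Fin 4} (hAB : A ≠ B) (hAf : A ≠ f) (hBν : B ≠ ν) (hBf : B ≠ f)
    (hνf : ν ≠ f) (s₁ : State K) (β' : K) (hq : ((5 : ℕ) : ℕ∞) ≤ ordAlong Finset.univ s₁.F)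
    (h6 : ∀ E ∈ s₁.F.support, 6 ≤ E.degree) (hbd : ∀ E ∈ s₁.F.support, 1 ≤ E A ∧ 1 ≤ E ν)
    (hone : ∀ E ∈ s₁.F.support, E A = 1 → E.degree = 6)
    (hsix : ∀ E ∈ s₁.F.support, E.degree = 6 → 4 ≤ E A + E ν) {s₂ : State K}
    (hs₂ : s₂ = CentreBlowup.step 5 Finset.univ B (Pi.single f β') s₁) :
    ∀ T ∈ s₂.F.support, 5 ≤ T A + T B + T ν := by
  subst hs₂
  intro T hT
  obtain ⟨E, hE, hj, -, hi⟩ := exists_source_of_mem_support_step_single 5 hBf β' s₁ hq hT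
  have h6E := h6 E hE
  obtain ⟨hA, hν⟩ := hbd E hE
  rw [hj, hi A hAB hAf, hi ν hBν.symm hνf]
  by_cases hEA : E A = 1
  · have h := hsix E hE (hone E hE hEA)
    omega
  · by_cases hdeg : E.degree = 6
    · have h := hsix E hE hdeg
      omega
    · omega

omit [DecidableEq K] in
/-- `5 ≤ ord_{(x_A, x_B, x_ν)} F` from the exponent bound, and the `x_f`-axis refutes isolation. [folklore] -/
theorem not_isIsolated_of_forall_five_le {A B ν f : Fin 4} (hAB : A ≠ B) (hAν : A ≠ ν) (hAf : A ≠ f)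
    (hBν : B ≠ ν) (hBf : B ≠ f) (hνf : ν ≠ f) {F : MvPolynomial (Fin 4) K}
    (h : ∀ T ∈ F.support, 5 ≤ T A + T B + T ν) : ¬ IsIsolated 5 F := by
  classical
  refine IsolationCert.not_isIsolated_of_le_ordAlong_of_ne_univ (S := {A, B, ν}) ?_ ?_
  · unfold ordAlong
    refine Finset.le_inf fun T hT => ?_
    unfold degIn
    rw [Finset.sum_insert (by simp [hAB, hAν]), Finset.sum_pair hBν]
    exact_mod_cast (show 5 ≤ T A + (T B + T ν) by have := h T hT; omega)
  · intro hu
    have hf : f ∈ ({A, B, ν} : Finset (Fin 4)) := hu ▸ Finset.mem_univ f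
    simp only [Finset.mem_insert, Finset.mem_singleton] at hf
    rcases hf with h | h | h
    · exact hAf h.symm
    · exact hBf h.symm
    · exact hνf h.symm

/-! ## 5. The L-sector letter change is fatal -/

/-- **THE L-SECTOR DIES IN TWO STEPS (exponent dress).** Boundary `x_A x_B x_ν` (weights read as `1 ≤` exponent
bounds), order `6` kept at the middle state (`p = q = 5`, `d = 3`): if the degree-`6` monomials of `F₀` have
`A`-exponent `1` and no `x_f` (cone in `K[x_B, x_ν]`: L-sector and the direction of the `A`-step) and the degree-`6`
monomials of `F₁` have `A`- plus `ν`-exponent `≥ 4` (cone in `K[x_A, x_ν]`: L-sector and the direction of the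
`B`-step), then after the slot steps `A` (translation `β e_f`) and `B` (translation `β′ e_f`) the state is NOT an
isolated `5`-fold point. [OURS] [folklore] -/
theorem not_isIsolated_after_lSector_change {A B ν f : Fin 4} (hAB : A ≠ B) (hAν : A ≠ ν) (hAf : A ≠ f)
    (hBν : B ≠ ν) (hBf : B ≠ f) (hνf : ν ≠ f) (s₀ : State K) (β β' : K)
    (hq₀ : ((5 : ℕ) : ℕ∞) ≤ ordAlong Finset.univ s₀.F) (h6₀ : ∀ D ∈ s₀.F.support, 6 ≤ D.degree)
    (hbd₀ : ∀ D ∈ s₀.F.support, 1 ≤ D B ∧ 1 ≤ D ν)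
    (hcone₀ : ∀ D ∈ s₀.F.support, D.degree = 6 → D A = 1 ∧ D f = 0)
    {s₁ : State K} (hs₁ : s₁ = CentreBlowup.step 5 Finset.univ A (Pi.single f β) s₀)
    (hq₁ : ((5 : ℕ) : ℕ∞) ≤ ordAlong Finset.univ s₁.F) (h6₁ : ∀ E ∈ s₁.F.support, 6 ≤ E.degree)
    (hcone₁ : ∀ E ∈ s₁.F.support, E.degree = 6 → 4 ≤ E A + E ν)
    {s₂ : State K} (hs₂ : s₂ = CentreBlowup.step 5 Finset.univ B (Pi.single f β') s₁) :
    ¬ IsIsolated 5 s₂.F := by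
  obtain ⟨hbd₁, hone⟩ := exponents_after_slot_step_A hAB hAν hAf hBν hBf hνf s₀ β hq₀ h6₀ hbd₀ hcone₀ hs₁
  exact not_isIsolated_of_forall_five_le hAB hAν hAf hBν hBf hνf
    (five_le_after_slot_step_B hAB hAf hBν hBf hνf s₁ β' hq₁ h6₁ (fun E hE => ⟨(hbd₁ E hE).1, (hbd₁ E hE).2.2⟩)
      hone hcone₁ hs₂)

/-- **THE L-SECTOR DIES IN TWO STEPS (cone dress).** The same with the hypotheses read off the residual power
cones: at `s₀` the cone is `a₀ (Σ ℓ₀ᵢ xᵢ)^3` with `ℓ₀ A = 0` (direction of the `A`-step) and `ℓ₀ f = 0` (L-sector);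
at `s₁` it is `a₁ (Σ ℓ₁ᵢ xᵢ)^3` with `ℓ₁ B = 0` and `ℓ₁ f = 0`; boundary `r = e_A + e_B + e_ν` at both, `x^r ∣ F`,
orders `6`.  [OURS] [folklore] -/
theorem not_isIsolated_after_lSector_change_of_forms {A B ν f : Fin 4} (hAB : A ≠ B) (hAν : A ≠ ν)
    (hAf : A ≠ f) (hBν : B ≠ ν) (hBf : B ≠ f) (hνf : ν ≠ f) (s₀ : State K) (β β' : K)
    (ho₀ : ordZero s₀.F = 6) (hr₀ : ∀ d ∈ s₀.F.support, s₀.r ≤ d)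
    (hrABν₀ : s₀.r = Finsupp.single A 1 + Finsupp.single B 1 + Finsupp.single ν 1)
    {a₀ : K} {ℓ₀ : Fin 4 → K} (hform₀ : resForm s₀ = C a₀ * (∑ i, C (ℓ₀ i) * X i) ^ 3)
    (hℓ₀A : ℓ₀ A = 0) (hℓ₀f : ℓ₀ f = 0)
    {s₁ : State K} (hs₁ : s₁ = CentreBlowup.step 5 Finset.univ A (Pi.single f β) s₀)
    (ho₁ : ordZero s₁.F = 6) (hr₁ : ∀ d ∈ s₁.F.support, s₁.r ≤ d)
    (hrABν₁ : s₁.r = Finsupp.single A 1 + Finsupp.single B 1 + Finsupp.single ν 1)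
    {a₁ : K} {ℓ₁ : Fin 4 → K} (hform₁ : resForm s₁ = C a₁ * (∑ i, C (ℓ₁ i) * X i) ^ 3)
    (hℓ₁B : ℓ₁ B = 0) (hℓ₁f : ℓ₁ f = 0)
    {s₂ : State K} (hs₂ : s₂ = CentreBlowup.step 5 Finset.univ B (Pi.single f β') s₁) :
    ¬ IsIsolated 5 s₂.F := by
  have hq₀ : ((5 : ℕ) : ℕ∞) ≤ ordAlong Finset.univ s₀.F := by
    refine le_ordAlong_iff.mpr fun d hd => ?_
    rw [degIn_univ]
    exact_mod_cast le_trans (by norm_num) (le_degree_of_mem_support_of_ordZero ho₀ hd)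
  have hq₁ : ((5 : ℕ) : ℕ∞) ≤ ordAlong Finset.univ s₁.F := by
    refine le_ordAlong_iff.mpr fun d hd => ?_
    rw [degIn_univ]
    exact_mod_cast le_trans (by norm_num) (le_degree_of_mem_support_of_ordZero ho₁ hd)
  have hq := triple_apply hAB hAν hAf hBν hBf hνf
  refine not_isIsolated_after_lSector_change hAB hAν hAf hBν hBf hνf s₀ β β' hq₀
    (fun D hD => le_degree_of_mem_support_of_ordZero ho₀ hD) (fun D hD => ?_)
    (cone_exponents_first hAB hAν hAf hBν hBf hνf ho₀ hr₀ hrABν₀ fun μ hμ =>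
      ⟨apply_eq_zero_of_mem_support_C_mul_linearForm_pow hℓ₀A (hform₀ ▸ hμ),
        apply_eq_zero_of_mem_support_C_mul_linearForm_pow hℓ₀f (hform₀ ▸ hμ)⟩)
    hs₁ hq₁ (fun E hE => le_degree_of_mem_support_of_ordZero ho₁ hE) (fun E hE hdeg => ?_) hs₂
  · have h := hr₀ D hD
    have hB := h B
    have hν := h ν
    rw [hrABν₀, hq.2.1] at hB
    rw [hrABν₀, hq.2.2.1] at hν
    exact ⟨hB, hν⟩
  · have h := cone_exponents_second hAB hAν hAf hBν hBf hνf ho₁ hr₁ hrABν₁ (fun μ hμ =>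
      ⟨apply_eq_zero_of_mem_support_C_mul_linearForm_pow hℓ₁B (hform₁ ▸ hμ),
        apply_eq_zero_of_mem_support_C_mul_linearForm_pow hℓ₁f (hform₁ ▸ hμ)⟩) E hE hdeg
    omega

end ResCone

end Summit.ResolutionOfSingularities.ResolutionOfSingularities.Theorems.PIDim4
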